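import Literature.Probability.RandomPlanarGeometry.SAWPatternCounting
import Literature.Probability.RandomPlanarGeometry.SAWSnakeRoute
import HarnessLib

/-!
# Self-avoiding walk on `ℤ^{d+2}`: marker times for Kesten's pattern theorem, and the two
# counting inequalities

Continuation of `SAWPatternCounting.lean` (the abstract counting inequality
`sum_choose_le_of_codes` of the cube surgery), following N. Madras, G. Slade, *The Self-Avoiding
Walk* (1993), §7.2, proofs of Lemma 7.2.6 and Theorem 7.2.3. Here we supply the concrete
ingredients of the two applications:

* the two marked route providers: `cubeProvider d` (radius `13`, the `(V,Q)`-route of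
  `SAWCubeRouting.exists_route`, marked at its clean occurrence of `(V, Q)`, Lemma 7.2.4 (b)) and
  `snakeProvider d` (radius `30`, the snake route of `SAWSnakeRoute.exists_snake_route`, marked at
  the centre of its fully covered radius-`13` cube, Lemma 7.2.4 (a));
* the recognisable marker times: for the snake route the marker time is an `E*`-time of the
  modified walk (`mtimeOf_mem_estarTimes`; `E*` = "the cube of radius `13` is completely
  covered"), and a walk without `E*`-times acquires at most `87^{d+2}` of them per operation
  (`card_estarTimes_op`, `card_estarTimes_PhiJ` — "since `E*` never occurs on `ω`, `E*` occurs no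
  more than `V|J|` times on `ψ`"); for the `(V,Q)`-route the marker time is a clean occurrence of
  `(V, Q)` on the modified walk (`occV_mtimeOf`) and each operation creates at most
  `(2m+49)^{d+2}` occurrences (`vCount_op`, `vCount_PhiJ` — "`v` has at most `aN + 2m'Vs`
  occurrences of `(P, Q)`");
* `Phi_additive` (bookkeeping of additive functionals along the operation),
  `exists_conflictFree_subset` (greedy selection of a conflict-free subset of proportional size)
  and `exists_validSet` (a valid set of sites among the surgery sites, "we can find
  `h₁ < ⋯ < h_u`, `u = ⌊a₁N/((2m+2)V)⌋ - 2`");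
* the two counting inequalities in the form "(number of walks) × C(u, s) ≤ (number of modified
  walks) × (data)": **`lemma726_counting`** ((7.2.20)–(7.2.21)) and **`thm723_counting`**
  ((7.2.25)–(7.2.26)).

Everything is proved; no named facts.
-/

noncomputable section

open Filter Topology Literature.Probability.LatticeModels Literature.Probability.Percolation SimpleGraph
open scoped BigOperators

namespace Literature.Probability.RandomPlanarGeometry.SAW.Zd

/-! ### Additive functionals along the multi-site operation -/

section Additive

variable {d : ℕ} {R : ℤ} {Λ m : ℕ}

/-- **A functional that grows by at most `C` under a single operation grows by at most `C s`
under the operation at `s` sites.** [folklore] -/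
theorem Phi_additive (ρ : RouteProvider d R Λ) (f : ℕ × (ℕ → Site (d + 2)) → ℕ) (C : ℕ)
    (hf : ∀ (N : ℕ) (ω : ℕ → Site (d + 2)) (j : ℕ), SurgerySite ω N R j (j - m) (j + m) →
      f (op ρ (N, ω) j) ≤ f (N, ω) + C) :
    ∀ (js : List ℕ) {N : ℕ} {ω : ℕ → Site (d + 2)}, Valid m R N ω js →
      f (Phi ρ (N, ω) js) ≤ f (N, ω) + C * js.length
  | [], _, _, _ => by simp [Phi]
  | j :: rest, N, ω, hv => by
    have ih := Phi_additive ρ f C hf rest (hv.op_cons (ρ := ρ))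
    have epair : ((op ρ (N, ω) j).1, (op ρ (N, ω) j).2) = op ρ (N, ω) j := Prod.mk.eta
    rw [epair] at ih
    have h1 := hf N ω j (hv.site j (by simp))
    simp only [Phi, List.length_cons]
    have : C * (rest.length + 1) = C * rest.length + C := by ring
    omega

/-- `Phi_additive` for the operation along a finite set. [folklore] -/
theorem PhiJ_additive (ρ : MarkedRouteProvider d R Λ) (f : ℕ × (ℕ → Site (d + 2)) → ℕ) (C : ℕ)
    (hf : ∀ (N : ℕ) (ω : ℕ → Site (d + 2)) (j : ℕ), SurgerySite ω N R j (j - m) (j + m) →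
      f (op ρ.toRouteProvider (N, ω) j) ≤ f (N, ω) + C)
    {N : ℕ} {ω : ℕ → Site (d + 2)} {J : Finset ℕ} (h : ValidSet m R N ω J) :
    f (PhiJ ρ N ω J) ≤ f (N, ω) + C * J.card := by
  rw [← length_sitesOf]
  exact Phi_additive ρ.toRouteProvider f C hf (sitesOf J) h.valid

end Additive

/-! ### Large pairwise compatible subsets (greedy selection) -/

section Compatible

/-- **Greedy selection**: in a finite set `S` with a symmetric conflict relation of degree at
most `W`, there is a conflict-free subset `M` with `|S| ≤ (W + 1) |M|` (a maximal conflict-free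
subset: every element of `S` is in `M` or conflicts with an element of `M`).
[cite: MadrasSlade1993, Lemma 7.2.6 (proof), choice of `h₁ < ⋯ < h_u`] -/
theorem exists_conflictFree_subset {α : Type*} [DecidableEq α] (S : Finset α) (r : α → α → Prop)
    [DecidableRel r] (hsymm : ∀ a b, r a b → r b a) (W : ℕ) (hdeg : ∀ a ∈ S, (S.filter (r a)).card ≤ W) :
    ∃ M ⊆ S, (∀ a ∈ M, ∀ b ∈ M, a ≠ b → ¬ r a b) ∧ S.card ≤ (W + 1) * M.card := by
  set F := S.powerset.filter fun M => ∀ a ∈ M, ∀ b ∈ M, a ≠ b → ¬ r a b with hF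
  have hne : F.Nonempty := ⟨∅, by simp [hF]⟩
  obtain ⟨M, hM, hmax⟩ := F.exists_max_image Finset.card hne
  rw [hF, Finset.mem_filter, Finset.mem_powerset] at hM
  refine ⟨M, hM.1, hM.2, ?_⟩
  -- every element of `S` is in `M` or conflicts with an element of `M`
  have hcov : S ⊆ M ∪ M.biUnion fun b => S.filter (r b) := by
    intro a ha
    by_contra hnot
    rw [Finset.mem_union, not_or, Finset.mem_biUnion] at hnot
    push Not at hnot
    have hins : insert a M ∈ F := by
      rw [hF, Finset.mem_filter, Finset.mem_powerset]
      refine ⟨Finset.insert_subset ha hM.1, fun x hx y hy hxy => ?_⟩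
      rw [Finset.mem_insert] at hx hy
      rcases hx with hxa | hxM
      · rcases hy with hya | hyM
        · exact absurd (hxa.trans hya.symm) hxy
        · intro hr
          rw [hxa] at hr
          exact hnot.2 y hyM (Finset.mem_filter.2 ⟨ha, hsymm _ _ hr⟩)
      · rcases hy with hya | hyM
        · intro hr
          rw [hya] at hr
          exact hnot.2 x hxM (Finset.mem_filter.2 ⟨ha, hr⟩)
        · exact hM.2 x hxM y hyM hxy
    have := hmax _ hins
    rw [Finset.card_insert_of_notMem hnot.1] at this
    omega
  calc S.card ≤ (M ∪ M.biUnion fun b => S.filter (r b)).card := Finset.card_le_card hcov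
    _ ≤ M.card + (M.biUnion fun b => S.filter (r b)).card := Finset.card_union_le _ _
    _ ≤ M.card + ∑ b ∈ M, (S.filter (r b)).card := by gcongr; exact Finset.card_biUnion_le
    _ ≤ M.card + ∑ b ∈ M, W := by gcongr with b hb; exact hdeg b (hM.1 hb)
    _ = (W + 1) * M.card := by rw [Finset.sum_const, smul_eq_mul]; ring

end Compatible

/-! ### The two marked route providers -/

section Providers

variable {d : ℕ}

/-- The hypotheses of the routing theorems: `x ≠ y` on the outer layer of `c + [-R,R]^{d+2}`.
[folklore] -/
def RouteHyp (R : ℤ) (c x y : Site (d + 2)) : Prop :=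
  (∀ j, |x j - c j| ≤ R) ∧ (∃ j, |x j - c j| = R) ∧ (∀ j, |y j - c j| ≤ R) ∧ (∃ j, |y j - c j| = R) ∧ x ≠ y

/-- `exists_route` with bundled hypotheses. [cite: MadrasSlade1993, Lemma 7.2.4 (b)] -/
theorem exists_route' {c x y : Site (d + 2)} (h : RouteHyp 13 c x y) :
    ∃ (L : ℕ) (π : ℕ → Site (d + 2)), L ≤ 156 * (d + 2) + 56 ∧ π 0 = x ∧ π L = y ∧ PathOn L π ∧
      (∀ t ≤ L, ∀ j, |π t j - c j| ≤ 13) ∧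
      ∃ k, k + 11 ≤ L ∧ (∀ s ≤ 11, π (k + s) = π k + vPt s) ∧
        (∀ t ≤ L, (t < k ∨ k + 11 < t) → ¬ InCube (π k) (π t)) ∧
        (∀ z, InCube (π k) z → ∀ j, |z j - c j| ≤ 12) :=
  exists_route c x y h.1 h.2.1 h.2.2.1 h.2.2.2.1 h.2.2.2.2

/-- `exists_snake_route` with bundled hypotheses. [cite: MadrasSlade1993, Lemma 7.2.4 (a)] -/
theorem exists_snake_route' {c x y : Site (d + 2)} (h : RouteHyp 30 c x y) :
    ∃ (L : ℕ) (π : ℕ → Site (d + 2)), L ≤ 27 ^ (d + 2) + 420 * (d + 2) + 1 ∧ π 0 = x ∧ π L = y ∧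
      PathOn L π ∧ (∀ t ≤ L, ∀ j, |π t j - c j| ≤ 30) ∧
      ∃ t₀ ≤ L, ∀ z : Site (d + 2), (∀ j, |z j - π t₀ j| ≤ 13) → ∃ t ≤ L, π t = z :=
  exists_snake_route c x y h.1 h.2.1 h.2.2.1 h.2.2.2.1 h.2.2.2.2

open Classical in
/-- **The `(V,Q)`-route provider** (radius `13`): the route of `SAWCubeRouting.exists_route`, marked
at the start of its clean occurrence of `(V, Q)`. [cite: MadrasSlade1993, Lemma 7.2.4 (b)] -/
def cubeProvider (d : ℕ) : MarkedRouteProvider d 13 (156 * (d + 2) + 56) where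
  len c x y := if h : RouteHyp 13 c x y then Classical.choose (exists_route' h) else 0
  path c x y := if h : RouteHyp 13 c x y then Classical.choose (Classical.choose_spec (exists_route' h)) else fun _ => x
  spec c x y hx hxL hy hyL hne := by
    have h : RouteHyp 13 c x y := ⟨hx, hxL, hy, hyL, hne⟩
    simp only [dif_pos h]
    have := Classical.choose_spec (Classical.choose_spec (exists_route' h))
    exact ⟨this.1, this.2.1, this.2.2.1, this.2.2.2.1, this.2.2.2.2.1⟩
  mtime c x y := if h : RouteHyp 13 c x y then
      Classical.choose (Classical.choose_spec (Classical.choose_spec (exists_route' h))).2.2.2.2.2 else 0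
  mtime_le c x y := by
    by_cases h : RouteHyp 13 c x y
    · simp only [dif_pos h]
      have := Classical.choose_spec (Classical.choose_spec (Classical.choose_spec (exists_route' h))).2.2.2.2.2
      exact le_trans (Nat.le_add_right _ _) this.1
    · simp only [dif_neg h]; exact le_rfl

/-- **The marker of the `(V,Q)`-route**: a clean occurrence of `(V, Q)` on the route starting at
the marker time, whose cube lies within radius `12`. [cite: MadrasSlade1993, Lemma 7.2.4 (b)] -/
theorem cubeProvider_marker {c x y : Site (d + 2)} (h : RouteHyp 13 c x y) :
    (cubeProvider d).mtime c x y + 11 ≤ (cubeProvider d).len c x y ∧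
    (∀ s ≤ 11, (cubeProvider d).path c x y ((cubeProvider d).mtime c x y + s) =
      (cubeProvider d).path c x y ((cubeProvider d).mtime c x y) + vPt s) ∧
    (∀ t ≤ (cubeProvider d).len c x y, (t < (cubeProvider d).mtime c x y ∨ (cubeProvider d).mtime c x y + 11 < t) →
      ¬ InCube ((cubeProvider d).path c x y ((cubeProvider d).mtime c x y)) ((cubeProvider d).path c x y t)) ∧
    (∀ z, InCube ((cubeProvider d).path c x y ((cubeProvider d).mtime c x y)) z → ∀ j, |z j - c j| ≤ 12) := by
  simp only [cubeProvider, dif_pos h]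
  exact Classical.choose_spec (Classical.choose_spec (Classical.choose_spec (exists_route' h))).2.2.2.2.2

open Classical in
/-- **The snake-route provider** (radius `30`): the route of `SAWSnakeRoute.exists_snake_route`,
marked at the centre of its fully covered radius-`13` cube. [cite: MadrasSlade1993, Lemma 7.2.4 (a)] -/
def snakeProvider (d : ℕ) : MarkedRouteProvider d 30 (27 ^ (d + 2) + 420 * (d + 2) + 1) where
  len c x y := if h : RouteHyp 30 c x y then Classical.choose (exists_snake_route' h) else 0
  path c x y := if h : RouteHyp 30 c x y then Classical.choose (Classical.choose_spec (exists_snake_route' h))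
    else fun _ => x
  spec c x y hx hxL hy hyL hne := by
    have h : RouteHyp 30 c x y := ⟨hx, hxL, hy, hyL, hne⟩
    simp only [dif_pos h]
    have := Classical.choose_spec (Classical.choose_spec (exists_snake_route' h))
    exact ⟨this.1, this.2.1, this.2.2.1, this.2.2.2.1, this.2.2.2.2.1⟩
  mtime c x y := if h : RouteHyp 30 c x y then
      Classical.choose (Classical.choose_spec (Classical.choose_spec (exists_snake_route' h))).2.2.2.2.2 else 0
  mtime_le c x y := by
    by_cases h : RouteHyp 30 c x y
    · simp only [dif_pos h]
      exact (Classical.choose_spec (Classical.choose_spec (Classical.choose_spec (exists_snake_route' h))).2.2.2.2.2).1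
    · simp only [dif_neg h]; exact le_rfl

/-- **The marker of the snake route**: the radius-`13` cube around the marker point consists of
points of the route. [cite: MadrasSlade1993, Lemma 7.2.4 (a)] -/
theorem snakeProvider_marker {c x y : Site (d + 2)} (h : RouteHyp 30 c x y) :
    ∀ z : Site (d + 2), (∀ j, |z j - (snakeProvider d).path c x y ((snakeProvider d).mtime c x y) j| ≤ 13) →
      ∃ t ≤ (snakeProvider d).len c x y, (snakeProvider d).path c x y t = z := by
  simp only [snakeProvider, dif_pos h]
  exact (Classical.choose_spec (Classical.choose_spec (Classical.choose_spec (exists_snake_route' h))).2.2.2.2.2).2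

/-- At a surgery site the route hypotheses hold for the entry and exit points. [folklore] -/
theorem routeHyp_of_surgerySite {R : ℤ} {m N j : ℕ} {ω : ℕ → Site (d + 2)} (h : SurgerySite ω N R j (j - m) (j + m)) :
    RouteHyp R (ω j) (ω (fvis R ω j)) (ω (lastVisit R (ω j) ω N)) := by
  have hjN : j ≤ N := by have := h.j_le; have := h.lt_N; omega
  rw [fvis_eq h.exists_visit]
  exact ⟨inBall_firstVisit h.exists_visit, h.entry_outer, inBall_lastVisit hjN fun k => by simp [h.nonneg],
    h.exit_outer, h.entry_ne_exit⟩

end Providers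

/-! ### Cubes as finite sets; displacement of a walk -/

section Balls

variable {d : ℕ}

/-- The cube `c + [-n, n]^{d+2}` as a finite set. [folklore] -/
def ballF (n : ℕ) (c : Site (d + 2)) : Finset (Site (d + 2)) := (box (d + 2) n).image fun v => c + v

/-- Membership in `ballF`. [folklore] -/
theorem mem_ballF {n : ℕ} {c z : Site (d + 2)} : z ∈ ballF n c ↔ InBall n c z := by
  unfold ballF InBall
  rw [Finset.mem_image]
  constructor
  · rintro ⟨v, hv, rfl⟩ k
    rw [mem_box] at hv
    have := hv k
    simp only [Pi.add_apply, add_sub_cancel_left]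
    exact abs_le.2 ⟨this.1, this.2⟩
  · intro h
    refine ⟨z - c, ?_, by abel⟩
    rw [mem_box]
    intro k
    have := abs_le.1 (h k)
    simp only [Pi.sub_apply]
    exact ⟨this.1, this.2⟩

/-- `#ballF = (2n+1)^{d+2}`. [folklore] -/
theorem card_ballF (n : ℕ) (c : Site (d + 2)) : (ballF n c).card = (2 * n + 1) ^ (d + 2) := by
  unfold ballF
  rw [Finset.card_image_of_injective _ (add_right_injective c), card_box]

/-- An injective walk spends at most `(2n+1)^{d+2}` times in a cube of radius `n`. [folklore] -/
theorem card_times_inBall {n N : ℕ} {c : Site (d + 2)} {ψ : ℕ → Site (d + 2)} (hψ : Set.InjOn ψ {t | t ≤ N})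
    (P : ℕ → Prop) [DecidablePred P] (hP : ∀ t ≤ N, P t → InBall n c (ψ t)) :
    ((Finset.range (N + 1)).filter P).card ≤ (2 * n + 1) ^ (d + 2) := by
  rw [← card_ballF n c]
  refine Finset.card_le_card_of_injOn ψ (fun t ht => ?_) fun t ht t' ht' h => ?_
  · rw [Finset.mem_coe, Finset.mem_filter, Finset.mem_range] at ht
    exact mem_ballF.2 (hP t (by omega) ht.2)
  · rw [Finset.mem_coe, Finset.mem_filter, Finset.mem_range] at ht ht'
    exact hψ (show t ≤ N by omega) (show t' ≤ N by omega) h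

/-- A self-avoiding walk moves by at most `u` (in every coordinate) in `u` steps. [folklore] -/
theorem abs_sub_le_of_mem_saws {N : ℕ} {ω : ℕ → Site (d + 2)} (h : ω ∈ saws (d + 2) N) (a u : ℕ) (k : Fin (d + 2)) :
    |ω (a + u) k - ω a k| ≤ u := by
  induction u with
  | zero => simp
  | succ u ih =>
    have hstep : |ω (a + u + 1) k - ω (a + u) k| ≤ 1 := by
      rcases lt_or_ge (a + u) N with hlt | hge
      · exact abs_sub_le_one_of_adj ((mem_saws.1 h).2.2.1 _ hlt) k
      · rw [(mem_saws.1 h).2.1 _ (by omega : N ≤ a + u + 1), (mem_saws.1 h).2.1 _ hge]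
        simp
    calc |ω (a + (u + 1)) k - ω a k| = |(ω (a + u + 1) k - ω (a + u) k) + (ω (a + u) k - ω a k)| := by ring_nf
      _ ≤ |ω (a + u + 1) k - ω (a + u) k| + |ω (a + u) k - ω a k| := abs_add_le _ _
      _ ≤ ((u + 1 : ℕ) : ℤ) := by push_cast; linarith

/-- Two times at distance `≤ u` of a self-avoiding walk are in each other's cube of radius `u`.
[folklore] -/
theorem inBall_of_near {N : ℕ} {ω : ℕ → Site (d + 2)} (h : ω ∈ saws (d + 2) N) {a b u : ℕ} (h1 : a ≤ b + u)
    (h2 : b ≤ a + u) : InBall u (ω a) (ω b) := by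
  intro k
  rcases le_total a b with hab | hab
  · obtain ⟨v, rfl⟩ : ∃ v, b = a + v := ⟨b - a, by omega⟩
    exact (abs_sub_le_of_mem_saws h a v k).trans (by exact_mod_cast (by omega : v ≤ u))
  · obtain ⟨v, rfl⟩ : ∃ v, a = b + v := ⟨a - b, by omega⟩
    rw [abs_sub_comm]
    exact (abs_sub_le_of_mem_saws h b v k).trans (by exact_mod_cast (by omega : v ≤ u))

/-- Monotonicity of cubes in the radius. [folklore] -/
theorem InBall.mono {R R' : ℤ} {c z : Site (d + 2)} (h : InBall R c z) (hR : R ≤ R') : InBall R' c z :=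
  fun k => (h k).trans hR

/-- Triangle inequality for cubes. [folklore] -/
theorem InBall.triangle {R R' : ℤ} {c y z : Site (d + 2)} (h : InBall R c y) (h' : InBall R' y z) :
    InBall (R + R') c z := fun k => by
  calc |z k - c k| = |(z k - y k) + (y k - c k)| := by ring_nf
    _ ≤ |z k - y k| + |y k - c k| := abs_add_le _ _
    _ ≤ R' + R := add_le_add (h' k) (h k)
    _ = R + R' := add_comm _ _

/-- Symmetry of the cube relation. [folklore] -/
theorem InBall.symm {R : ℤ} {y z : Site (d + 2)} (h : InBall R y z) : InBall R z y := fun k => by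
  rw [abs_sub_comm]; exact h k

end Balls

/-! ### The covering event `E*` and its marker times under surgery -/

section Estar

variable {d : ℕ} {R : ℤ} {Λ m N j : ℕ} {ω : ℕ → Site (d + 2)}

/-- **`E*` occurs at the time `t` of the walk `w = (N, ψ)`**: the cube of radius `13` centred at
`ψ t` is completely covered by `ψ[0, N]`. (Radius `13` is the radius of the cube `Q̄ = Q ⊕ 2`
of the `(V,Q)`-routing, cf. `SAWCubeRouting`.) [cite: MadrasSlade1993, before Lemma 7.2.5] -/
def Estar (w : ℕ × (ℕ → Site (d + 2))) (t : ℕ) : Prop := ∀ z, InBall 13 (w.2 t) z → ∃ t' ≤ w.1, w.2 t' = z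

open Classical in
/-- The times `≤ N` at which `E*` occurs. [cite: MadrasSlade1993, before Lemma 7.2.5] -/
def estarTimes (w : ℕ × (ℕ → Site (d + 2))) : Finset ℕ := (Finset.range (w.1 + 1)).filter (Estar w)

/-- Membership in `estarTimes`. [folklore] -/
theorem mem_estarTimes {w : ℕ × (ℕ → Site (d + 2))} {t : ℕ} : t ∈ estarTimes w ↔ t ≤ w.1 ∧ Estar w t := by
  classical
  unfold estarTimes
  rw [Finset.mem_filter, Finset.mem_range, Nat.lt_succ_iff]

/-- **`E*`-times under a single operation**: at most `(2(R+13)+1)^{d+2}` new ones (those whose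
point is within `R + 13` of the centre), the others come injectively from `E*`-times of `ω`.
[cite: MadrasSlade1993, Lemma 7.2.6 (proof), "E* occurs no more than V|J| times on ψ"] -/
theorem card_estarTimes_op (ρ : RouteProvider d R Λ) (hR : 0 ≤ R) (h : SurgerySite ω N R j (j - m) (j + m)) :
    (estarTimes (op ρ (N, ω) j)).card ≤ (estarTimes (N, ω)).card + (2 * (R.toNat + 13) + 1) ^ (d + 2) := by
  classical
  obtain ⟨hmemψ, -, -, -⟩ := op_mem_saws ρ h
  have hinjψ := (mem_saws.1 hmemψ).2.2.2
  have hRR : ((R.toNat + 13 : ℕ) : ℤ) = R + 13 := by push_cast; rw [Int.toNat_of_nonneg hR]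
  set A := (estarTimes (op ρ (N, ω) j)).filter fun t => InBall (R.toNat + 13 : ℕ) (ω j) ((op ρ (N, ω) j).2 t)
    with hA
  set B := (estarTimes (op ρ (N, ω) j)).filter fun t => ¬ InBall (R.toNat + 13 : ℕ) (ω j) ((op ρ (N, ω) j).2 t)
    with hB
  have hsplit : (estarTimes (op ρ (N, ω) j)).card = A.card + B.card := by
    rw [hA, hB, Finset.card_filter_add_card_filter_not]
  have hAcard : A.card ≤ (2 * (R.toNat + 13) + 1) ^ (d + 2) := by
    rw [hA, estarTimes, Finset.filter_filter]
    exact card_times_inBall hinjψ _ fun t _ ht => ht.2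
  -- the old points: `ψ t = ω t'`
  have hold : ∀ t ∈ B, ∃ t' ≤ N, (op ρ (N, ω) j).2 t = ω t' := by
    intro t ht
    rw [hB, Finset.mem_filter] at ht
    rcases op_point ρ h t with ⟨t', -, ht'N, e⟩ | ⟨hin, -, -⟩
    · exact ⟨t', ht'N, e⟩
    · exact absurd (hin.mono (by rw [hRR]; linarith)) ht.2
  set g : ℕ → ℕ := fun t => Nat.findGreatest (fun t' => ω t' = (op ρ (N, ω) j).2 t) N with hg
  have hgspec : ∀ t ∈ B, g t ≤ N ∧ ω (g t) = (op ρ (N, ω) j).2 t := by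
    intro t ht
    obtain ⟨t', ht'N, e⟩ := hold t ht
    exact ⟨Nat.findGreatest_le _, Nat.findGreatest_spec (P := fun t' => ω t' = (op ρ (N, ω) j).2 t) ht'N e.symm⟩
  have hBcard : B.card ≤ (estarTimes (N, ω)).card := by
    refine Finset.card_le_card_of_injOn g (fun t ht => ?_) fun t ht t₂ ht₂ hgg => ?_
    · rw [Finset.mem_coe] at ht
      obtain ⟨hgN, hgω⟩ := hgspec t ht
      rw [hB, Finset.mem_filter, mem_estarTimes] at ht
      obtain ⟨⟨htN', hE⟩, hfar⟩ := ht
      rw [Finset.mem_coe, mem_estarTimes]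
      refine ⟨hgN, fun z hz => ?_⟩
      simp only at hz ⊢
      rw [hgω] at hz
      obtain ⟨t₁, ht₁, e₁⟩ := hE z hz
      rcases op_point ρ h t₁ with ⟨t₃, -, ht₃N, e₃⟩ | ⟨hin, -, -⟩
      · exact ⟨t₃, ht₃N, by rw [← e₃, e₁]⟩
      · exfalso
        rw [e₁] at hin
        refine hfar ?_
        have := hin.triangle hz.symm
        rw [hRR]
        exact this
    · rw [Finset.mem_coe] at ht ht₂
      have e1 := (hgspec t ht).2
      have e2 := (hgspec t₂ ht₂).2
      rw [hgg] at e1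
      rw [hB, Finset.mem_filter, mem_estarTimes] at ht ht₂
      exact hinjψ ht.1.1 ht₂.1.1 (e1.symm.trans e2)
  omega

/-- **The marker time of the snake route is an `E*`-time of the final walk.**
[cite: MadrasSlade1993, Lemma 7.2.6 (proof), "a self-avoiding walk ψ on which E* occurs at least s times"] -/
theorem mtimeOf_mem_estarTimes {J : Finset ℕ} (h : ValidSet m 30 N ω J) {l : ℕ} (hl : l ∈ J) :
    mtimeOf (snakeProvider d) N ω J l ∈ estarTimes (PhiJ (snakeProvider d) N ω J) := by
  obtain ⟨t₀, ht₀, hblk, he⟩ := mtimeOf_block (snakeProvider d) h hl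
  have hmt := mtAt_le (snakeProvider d) ω l (N := N)
  rw [mem_estarTimes, he]
  refine ⟨by omega, fun z hz => ?_⟩
  rw [hblk _ hmt] at hz
  obtain ⟨t, ht, e⟩ := snakeProvider_marker (routeHyp_of_surgerySite (h.site l hl)) z hz
  change t ≤ lenAt (snakeProvider d).toRouteProvider N ω l at ht
  refine ⟨t₀ + t, ?_, by rw [hblk t ht]; exact e⟩
  change t₀ + lenAt (snakeProvider d).toRouteProvider N ω l ≤ (PhiJ (snakeProvider d) N ω J).1 at ht₀
  omega

/-- **At most `87^{d+2} s` `E*`-times on the final walk** when `ω` has none.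
[cite: MadrasSlade1993, Lemma 7.2.6 (proof), "at most (V|J| choose |J|) possibilities"] -/
theorem card_estarTimes_PhiJ {J : Finset ℕ} (h : ValidSet m 30 N ω J) (h0 : (estarTimes (N, ω)).card = 0) :
    (estarTimes (PhiJ (snakeProvider d) N ω J)).card ≤ 87 ^ (d + 2) * J.card := by
  have := PhiJ_additive (snakeProvider d) (fun w => (estarTimes w).card) (87 ^ (d + 2)) (m := m)
    (fun N ω j hj => by
      have := card_estarTimes_op (snakeProvider d).toRouteProvider (by norm_num) hj
      simpa using this) h
  simpa [h0] using this

end Estar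

/-! ### Occurrences of `(V, Q)` under surgery -/

section OccVMarkers

variable {d : ℕ} {R : ℤ} {Λ m N j : ℕ} {ω : ℕ → Site (d + 2)}

/-- A point of `Q = x + [0,3]^{d+2}` is within `3` of `x`. [folklore] -/
theorem InCube.inBall {x z : Site (d + 2)} (h : InCube x z) : InBall 3 x z := fun k => by
  have := h k; rw [abs_le]; constructor <;> linarith [this.1, this.2]

/-- **Occurrences of `(V,Q)` under a single operation**: at most `(2(R+m+11)+1)^{d+2}` new ones
(those starting within `R + m + 11` of the centre); the others come injectively from
occurrences on `ω`. [cite: MadrasSlade1993, Theorem 7.2.3 (proof), "v has at most aN + 2m'Vs occurrences"] -/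
theorem vCount_op (ρ : RouteProvider d R Λ) (hR : 0 ≤ R) (h : SurgerySite ω N R j (j - m) (j + m)) :
    vCount (op ρ (N, ω) j).1 (op ρ (N, ω) j).2 ≤ vCount N ω + (2 * (R.toNat + m + 11) + 1) ^ (d + 2) := by
  classical
  obtain ⟨hmemψ, -, -, -⟩ := op_mem_saws ρ h
  have hinjψ := (mem_saws.1 hmemψ).2.2.2
  obtain ⟨h1, h2, h3, h4, h5, h6⟩ := fvis_spec h
  obtain ⟨-, -, -, -, hinr⟩ := routeAt_spec ρ h
  have hop1 : (op ρ (N, ω) j).1 = fvis R ω j + lenAt ρ N ω j + (N - lastVisit R (ω j) ω N) := by rw [op_eq' h]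
  have hbefore : ∀ t ≤ fvis R ω j, (op ρ (N, ω) j).2 t = ω t := fun t ht =>
    op_apply_of_le ρ h (by rwa [← fvis_eq h.exists_visit])
  have hroute : ∀ s ≤ lenAt ρ N ω j, (op ρ (N, ω) j).2 (fvis R ω j + s) = routeAt ρ N ω j s := by
    intro s hs; rw [op_eq' h]; exact splice_piece (routeAt_spec ρ h).2.1 hs
  have hafter : ∀ u, (op ρ (N, ω) j).2 (fvis R ω j + lenAt ρ N ω j + u) = ω (lastVisit R (ω j) ω N + u) := by
    intro u; rw [op_eq' h]; exact splice_after (routeAt_spec ρ h).2.1 (routeAt_spec ρ h).2.2.1 u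
  have hRR : ((R.toNat + m + 11 : ℕ) : ℤ) = R + m + 11 := by push_cast; rw [Int.toNat_of_nonneg hR]
  set σ := fvis R ω j with hσ
  set τ := lastVisit R (ω j) ω N with hτ
  set L := lenAt ρ N ω j with hL
  set ψ := (op ρ (N, ω) j).2 with hψ
  set N' := (op ρ (N, ω) j).1 with hN'
  set r₀ := R.toNat + m + 11 with hr₀
  -- old points removed by the operation are within `m` of the centre
  have hremoved : ∀ i, σ < i → i < τ → InBall m (ω j) (ω i) := fun i hi1 hi2 =>
    inBall_of_near h.mem (by omega) (by omega)
  -- times of `ψ` near the route have their point within `r₀` of the centre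
  have hnear1 : ∀ t, σ ≤ t + 11 → t ≤ σ → InBall r₀ (ω j) (ψ t) := by
    intro t ht1 ht2
    rw [hbefore t ht2]
    exact (inBall_of_near h.mem (by omega) (by omega) : InBall (m + 11 : ℕ) (ω j) (ω t)).mono
      (by rw [hRR]; push_cast; linarith)
  have hnear2 : ∀ s ≤ L, InBall r₀ (ω j) (ψ (σ + s)) := by
    intro s hs
    rw [hroute s hs]
    exact (hinr s hs).mono (by rw [hRR]; linarith [Int.natCast_nonneg m])
  have hnear3 : ∀ u ≤ 11, InBall r₀ (ω j) (ψ (σ + L + u)) := by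
    intro u hu
    rw [hafter u]
    rcases le_or_gt (τ + u) N with hle | hgt
    · exact (inBall_of_near h.mem (by omega) (by omega) : InBall (m + 11 : ℕ) (ω j) (ω (τ + u))).mono
        (by rw [hRR]; push_cast; linarith)
    · rw [(mem_saws.1 h.mem).2.1 _ hgt.le]
      have hjN : j ≤ N := by have := h.j_le; have := h.lt_N; omega
      exact (inBall_of_near h.mem (by omega) (by omega) : InBall (m + 11 : ℕ) (ω j) (ω N)).mono
        (by rw [hRR]; push_cast; linarith)
  set A := (vSites N' ψ).filter fun t => InBall r₀ (ω j) (ψ t) with hA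
  set B := (vSites N' ψ).filter fun t => ¬ InBall r₀ (ω j) (ψ t) with hB
  have hsplit : vCount N' ψ = A.card + B.card := by
    rw [vCount, hA, hB, Finset.card_filter_add_card_filter_not]
  have hAcard : A.card ≤ (2 * r₀ + 1) ^ (d + 2) := by
    rw [hA, vSites, Finset.filter_filter]
    exact card_times_inBall hinjψ _ fun t _ ht => ht.2
  -- classification of the far occurrence times
  have hclass : ∀ t ∈ B, OccV N' ψ t ∧ ¬ InBall r₀ (ω j) (ψ t) ∧ (t + 11 < σ ∨ σ + L + 11 < t) := by
    intro t ht
    rw [hB, Finset.mem_filter, mem_vSites] at ht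
    refine ⟨ht.1, ht.2, ?_⟩
    by_contra hmid
    push Not at hmid
    rcases le_or_gt t σ with h1' | h1'
    · exact ht.2 (hnear1 t hmid.1 h1')
    · rcases le_or_gt t (σ + L) with h2' | h2'
      · obtain ⟨s, rfl⟩ : ∃ s, t = σ + s := ⟨t - σ, by omega⟩
        exact ht.2 (hnear2 s (by omega))
      · obtain ⟨u, rfl⟩ : ∃ u, t = σ + L + u := ⟨t - σ - L, by omega⟩
        exact ht.2 (hnear3 u (by omega))
  -- a far occurrence whose cube meets a removed point would be near the centre
  have hfar_clean : ∀ t ∈ B, ∀ i, σ < i → i < τ → ¬ InCube (ψ t) (ω i) := by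
    intro t ht i hi1 hi2 hcube
    obtain ⟨-, hfar, -⟩ := hclass t ht
    refine hfar ?_
    have h1' := hremoved i hi1 hi2
    have h2' := (hcube.inBall).symm
    exact (h1'.triangle h2').mono (by rw [hRR]; linarith [hR])
  set g : ℕ → ℕ := fun t => if t ≤ σ then t else t + τ - σ - L with hg
  have hBcard : B.card ≤ vCount N ω := by
    refine Finset.card_le_card_of_injOn g (fun t ht => ?_) fun t ht t₂ ht₂ hgg => ?_
    · rw [Finset.mem_coe] at ht
      obtain ⟨⟨htN', hpat, hclean⟩, hfar, hcase⟩ := hclass t ht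
      rw [Finset.mem_coe, mem_vSites]
      rcases hcase with hc | hc
      · -- early occurrence: unchanged
        have hgt : g t = t := by rw [hg]; simp [show t ≤ σ by omega]
        rw [hgt]
        refine ⟨by omega, fun s hs => ?_, fun i hi hio hcube => ?_⟩
        · rw [← hbefore (t + s) (by omega), ← hbefore t (by omega)]; exact hpat s hs
        · rcases le_or_gt i σ with hi1 | hi1
          · exact hclean i (by omega) hio (by rwa [hbefore t (by omega), hbefore i hi1])
          · rcases lt_or_ge i τ with hi2 | hi2
            · exact hfar_clean t ht i hi1 hi2 (by rwa [hbefore t (by omega)])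
            · obtain ⟨u, rfl⟩ : ∃ u, i = τ + u := ⟨i - τ, by omega⟩
              refine hclean (σ + L + u) (by omega) (Or.inr (by omega)) ?_
              rwa [hbefore t (by omega), hafter u]
      · -- late occurrence: shifted
        obtain ⟨u₀, rfl⟩ : ∃ u₀, t = σ + L + u₀ := ⟨t - σ - L, by omega⟩
        have hgt : g (σ + L + u₀) = τ + u₀ := by rw [hg]; simp [show ¬ (σ + L + u₀ ≤ σ) by omega]; omega
        rw [hgt]
        have hv0 : ψ (σ + L + u₀) = ω (τ + u₀) := hafter u₀
        refine ⟨by omega, fun s hs => ?_, fun i hi hio hcube => ?_⟩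
        · have := hpat s hs
          rwa [show σ + L + u₀ + s = σ + L + (u₀ + s) by omega, hafter, hv0, show τ + (u₀ + s) = τ + u₀ + s by omega]
            at this
        · rcases le_or_gt i σ with hi1 | hi1
          · exact hclean i (by omega) (Or.inl (by omega)) (by rwa [hv0, hbefore i hi1])
          · rcases lt_or_ge i τ with hi2 | hi2
            · exact hfar_clean _ ht i hi1 hi2 (by rwa [hv0])
            · obtain ⟨u, rfl⟩ : ∃ u, i = τ + u := ⟨i - τ, by omega⟩
              refine hclean (σ + L + u) (by omega) ?_ (by rwa [hv0, hafter u])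
              rcases hio with hio | hio
              · exact Or.inl (by omega)
              · exact Or.inr (by omega)
    · rw [Finset.mem_coe] at ht ht₂
      obtain ⟨-, -, hc1⟩ := hclass t ht
      obtain ⟨-, -, hc2⟩ := hclass t₂ ht₂
      simp only [hg] at hgg
      split_ifs at hgg with e1 e2 e2 <;> omega
  calc vCount N' ψ = A.card + B.card := hsplit
    _ ≤ (2 * r₀ + 1) ^ (d + 2) + vCount N ω := add_le_add hAcard hBcard
    _ = _ := add_comm _ _

/-- **The marker time of the `(V,Q)`-route is a clean occurrence of `(V, Q)` on the final walk.**
[cite: MadrasSlade1993, Theorem 7.2.3 (proof), "replacing the occurrence of E**(m') by an occurrence of (P,Q)"] -/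
theorem occV_mtimeOf {J : Finset ℕ} (h : ValidSet m 13 N ω J) {l : ℕ} (hl : l ∈ J) :
    OccV (PhiJ (cubeProvider d) N ω J).1 (PhiJ (cubeProvider d) N ω J).2 (mtimeOf (cubeProvider d) N ω J l) := by
  obtain ⟨t₀, ht₀, hblk, he⟩ := mtimeOf_block (cubeProvider d) h hl
  obtain ⟨hk, hpat, hclean, hcube⟩ := cubeProvider_marker (routeHyp_of_surgerySite (h.site l hl))
  have hinj := (mem_saws.1 (PhiJ_mem (cubeProvider d) h).1).2.2.2
  -- identify the route data
  change (cubeProvider d).mtime _ _ _ + 11 ≤ lenAt (cubeProvider d).toRouteProvider N ω l at hk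
  change ∀ s ≤ 11, routeAt (cubeProvider d).toRouteProvider N ω l (mtAt (cubeProvider d) N ω l + s) =
    routeAt (cubeProvider d).toRouteProvider N ω l (mtAt (cubeProvider d) N ω l) + vPt s at hpat
  change ∀ t ≤ lenAt (cubeProvider d).toRouteProvider N ω l, (t < mtAt (cubeProvider d) N ω l ∨
    mtAt (cubeProvider d) N ω l + 11 < t) → ¬ InCube (routeAt (cubeProvider d).toRouteProvider N ω l
      (mtAt (cubeProvider d) N ω l)) (routeAt (cubeProvider d).toRouteProvider N ω l t) at hclean
  change ∀ z, InCube (routeAt (cubeProvider d).toRouteProvider N ω l (mtAt (cubeProvider d) N ω l)) z →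
    ∀ j, |z j - ω l j| ≤ 12 at hcube
  change mtAt (cubeProvider d) N ω l + 11 ≤ lenAt (cubeProvider d).toRouteProvider N ω l at hk
  set k := mtAt (cubeProvider d) N ω l with hkdef
  set Lr := lenAt (cubeProvider d).toRouteProvider N ω l with hLr
  have hT : (PhiJ (cubeProvider d) N ω J).2 (t₀ + k) = routeAt (cubeProvider d).toRouteProvider N ω l k := hblk k (by omega)
  rw [he]
  refine ⟨by omega, fun s hs => ?_, fun i hi hio hcubei => ?_⟩
  · rw [show t₀ + k + s = t₀ + (k + s) by omega, hblk _ (by omega), hT]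
    exact hpat s hs
  · rw [hT] at hcubei
    have hin : InBall 13 (ω l) ((PhiJ (cubeProvider d) N ω J).2 i) := fun j' =>
      (hcube _ hcubei j').trans (by norm_num)
    obtain ⟨u, hu, eu⟩ := Phi_ball (ρ := (cubeProvider d).toRouteProvider) h.valid (mem_sitesOf.2 hl) hin
    change (PhiJ (cubeProvider d) N ω J).2 i = routeAt (cubeProvider d).toRouteProvider N ω l u at eu
    have hiu : i = t₀ + u := hinj hi (show t₀ + u ≤ _ by omega) (by rw [eu, hblk u hu])
    refine hclean u hu ?_ (by rwa [eu] at hcubei)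
    rcases hio with hio | hio
    · exact Or.inl (by omega)
    · exact Or.inr (by omega)

/-- **At most `vCount ω + (2m+49)^{d+2} s` occurrences of `(V, Q)` on the final walk.**
[cite: MadrasSlade1993, Theorem 7.2.3 (proof), "v has at most aN + 2m'Vs occurrences of (P,Q)"] -/
theorem vCount_PhiJ {J : Finset ℕ} (h : ValidSet m 13 N ω J) :
    vCount (PhiJ (cubeProvider d) N ω J).1 (PhiJ (cubeProvider d) N ω J).2 ≤
      vCount N ω + (2 * (m + 24) + 1) ^ (d + 2) * J.card := by
  have := PhiJ_additive (cubeProvider d) (fun w => vCount w.1 w.2) ((2 * (m + 24) + 1) ^ (d + 2)) (m := m)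
    (fun N ω j hj => by
      have := vCount_op (cubeProvider d).toRouteProvider (by norm_num) hj
      have e : (13 : ℤ).toNat + m + 11 = m + 24 := by norm_num; omega
      rw [e] at this
      simpa using this) h
  simpa using this

end OccVMarkers

/-! ### Extracting a valid set of sites; the two counting inequalities -/

section Applications

variable {d : ℕ} {m N : ℕ} {ω : ℕ → Site (d + 2)}

/-- **A large valid subset**: among surgery sites (with windows `[j-m, j+m]` and cube radius `R`)
of a self-avoiding walk there is a valid subset `M` (windows disjoint, cubes apart) with
`|S| ≤ (4m + 2 + (4R+1)^{d+2}) |M|`. [cite: MadrasSlade1993, Lemma 7.2.6 (proof), choice of `h₁ < ⋯ < h_u`] -/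
theorem exists_validSet (R : ℕ) (hω : ω ∈ saws (d + 2) N) (S : Finset ℕ)
    (hS : ∀ j ∈ S, SurgerySite ω N R j (j - m) (j + m)) :
    ∃ M ⊆ S, ValidSet m R N ω M ∧ S.card ≤ (4 * m + 1 + (4 * R + 1) ^ (d + 2) + 1) * M.card := by
  classical
  have hSN : ∀ j ∈ S, j ≤ N := fun j hj => by have := (hS j hj).j_le; have := (hS j hj).lt_N; omega
  have hsymm : ∀ a b, ((b ≤ a + 2 * m ∧ a ≤ b + 2 * m) ∨ InBall (2 * R : ℕ) (ω a) (ω b)) →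
      ((a ≤ b + 2 * m ∧ b ≤ a + 2 * m) ∨ InBall (2 * R : ℕ) (ω b) (ω a)) := by
    intro a b h
    rcases h with h | h
    · exact Or.inl ⟨h.2, h.1⟩
    · exact Or.inr h.symm
  have hdeg : ∀ a ∈ S, (S.filter fun b => (b ≤ a + 2 * m ∧ a ≤ b + 2 * m) ∨ InBall (2 * R : ℕ) (ω a) (ω b)).card ≤
      4 * m + 1 + (4 * R + 1) ^ (d + 2) := by
    intro a ha
    rw [Finset.filter_or]
    refine (Finset.card_union_le _ _).trans (add_le_add ?_ ?_)
    · calc (S.filter fun b => b ≤ a + 2 * m ∧ a ≤ b + 2 * m).card ≤ (Finset.Icc (a - 2 * m) (a + 2 * m)).card :=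
            Finset.card_le_card fun b hb => by
              rw [Finset.mem_filter] at hb; rw [Finset.mem_Icc]; omega
        _ ≤ 4 * m + 1 := by rw [Nat.card_Icc]; omega
    · calc (S.filter fun b => InBall (2 * R : ℕ) (ω a) (ω b)).card
            ≤ ((Finset.range (N + 1)).filter fun b => InBall (2 * R : ℕ) (ω a) (ω b)).card :=
            Finset.card_le_card (Finset.filter_subset_filter _ fun b hb => Finset.mem_range.2 (by
              have := hSN b hb; omega))
        _ ≤ (2 * (2 * R) + 1) ^ (d + 2) := card_times_inBall (mem_saws.1 hω).2.2.2 _ fun t _ ht => ht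
        _ = (4 * R + 1) ^ (d + 2) := by ring_nf
  obtain ⟨M, hMS, hfree, hcard⟩ := exists_conflictFree_subset S
    (fun a b => (b ≤ a + 2 * m ∧ a ≤ b + 2 * m) ∨ InBall (2 * R : ℕ) (ω a) (ω b)) hsymm _ hdeg
  refine ⟨M, hMS, ⟨hω, fun j hj => hS j (hMS hj), fun a ha b hb hab => ?_, fun a ha b hb hab => ?_⟩, hcard⟩
  · have := hfree a ha b hb hab.ne
    rw [not_or, not_and_or] at this
    omega
  · have := hfree a ha b hb hab
    rw [not_or] at this
    obtain ⟨-, h2⟩ := this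
    simp only [InBall, not_forall, not_le] at h2
    obtain ⟨k, hk⟩ := h2
    exact ⟨k, by rw [abs_sub_comm]; push_cast at hk ⊢; linarith⟩

/-- Lower bound for the sum of binomial coefficients over a family of large sets. [folklore] -/
theorem card_mul_choose_le_sum {α : Type*} (T : Finset α) (M : α → Finset ℕ) (u s : ℕ) (hu : ∀ ω ∈ T, u ≤ (M ω).card) :
    T.card * u.choose s ≤ ∑ ω ∈ T, (M ω).card.choose s := by
  calc T.card * u.choose s = ∑ ω ∈ T, u.choose s := by rw [Finset.sum_const, smul_eq_mul]
    _ ≤ _ := Finset.sum_le_sum fun ω hω => Nat.choose_le_choose s (hu ω hω)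

/-- **The counting inequality for Lemma 7.2.6** (`R = 30`, snake routes, `E*` markers): if every
walk of `T ⊆ S_N` has no `E*`-time and at least `(4m + 2 + 121^{d+2}) u` surgery sites of radius
`30` with windows `[j-m, j+m]`, then
`|T| · C(u, s) ≤ (Σ_{n ≤ N + Λ s} c_n) · C(87^{d+2} s, s) · (61^{d+2})^s · (2m+1)^s · (Σ_{n ≤ 2m} c_n)^s`,
`Λ = 27^{d+2} + 420(d+2) + 1`. [cite: MadrasSlade1993, Lemma 7.2.6 (proof), (7.2.20)–(7.2.21)] -/
theorem lemma726_counting (T : Finset (ℕ → Site (d + 2))) (S : (ℕ → Site (d + 2)) → Finset ℕ) (u s : ℕ)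
    (hT : ∀ ω ∈ T, ω ∈ saws (d + 2) N ∧ (estarTimes (N, ω)).card = 0 ∧
      (∀ j ∈ S ω, SurgerySite ω N 30 j (j - m) (j + m)) ∧ (4 * m + 1 + 121 ^ (d + 2) + 1) * u ≤ (S ω).card) :
    T.card * u.choose s ≤
      (∑ n ∈ Finset.range (N + (27 ^ (d + 2) + 420 * (d + 2) + 1) * s + 1), count (d + 2) n) * (87 ^ (d + 2) * s).choose s *
        ((2 * 30 + 1) ^ (d + 2)) ^ s * (2 * m + 1) ^ s * (∑ n ∈ Finset.range (2 * m + 1), count (d + 2) n) ^ s := by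
  classical
  -- choose the valid sets
  have hM : ∀ ω ∈ T, ∃ M ⊆ S ω, ValidSet m 30 N ω M ∧ u ≤ M.card := by
    intro ω hω
    obtain ⟨hmem, -, hS, hu⟩ := hT ω hω
    obtain ⟨M, hMS, hv, hcard⟩ := exists_validSet 30 hmem (S ω) hS
    refine ⟨M, hMS, by exact_mod_cast hv, ?_⟩
    have : (4 * m + 1 + (4 * 30 + 1) ^ (d + 2) + 1) * u ≤ (4 * m + 1 + (4 * 30 + 1) ^ (d + 2) + 1) * M.card :=
      (by norm_num at hu ⊢; exact hu : _ ≤ (S ω).card).trans hcard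
    exact le_of_mul_le_mul_left this (by positivity)
  choose! M hMS hMv hMu using hM
  refine (card_mul_choose_le_sum T M u s hMu).trans ?_
  have := sum_choose_le_of_codes estarTimes (snakeProvider d) N s (87 ^ (d + 2) * s) T M (fun ω hω => hMv ω hω)
    (fun ω hω J hJ hs l hl => mtimeOf_mem_estarTimes ((hMv ω hω).subset hJ) hl)
    (fun ω hω J hJ hs => by
      rw [← hs]; exact card_estarTimes_PhiJ ((hMv ω hω).subset hJ) (hT ω hω).2.1) (by norm_num)
  simpa using this

/-- **The counting inequality for Theorem 7.2.3** (`R = 13`, `(V,Q)`-routes, `(V,Q)` markers): if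
every walk of `T ⊆ S_N` has at most `A₀` occurrences of `(V, Q)` and at least
`(4m + 2 + 53^{d+2}) u` surgery sites of radius `13` with windows `[j-m, j+m]`, then
`|T| · C(u, s) ≤ (Σ_{n ≤ N + Λ s} c_n) · C(A₀ + (2m+49)^{d+2} s, s) · (27^{d+2})^s · (2m+1)^s · (Σ_{n ≤ 2m} c_n)^s`,
`Λ = 156(d+2) + 56`. [cite: MadrasSlade1993, Theorem 7.2.3 (proof), (7.2.25)–(7.2.26)] -/
theorem thm723_counting (T : Finset (ℕ → Site (d + 2))) (S : (ℕ → Site (d + 2)) → Finset ℕ) (u s A₀ : ℕ)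
    (hT : ∀ ω ∈ T, ω ∈ saws (d + 2) N ∧ vCount N ω ≤ A₀ ∧
      (∀ j ∈ S ω, SurgerySite ω N 13 j (j - m) (j + m)) ∧ (4 * m + 1 + 53 ^ (d + 2) + 1) * u ≤ (S ω).card) :
    T.card * u.choose s ≤
      (∑ n ∈ Finset.range (N + (156 * (d + 2) + 56) * s + 1), count (d + 2) n) *
        (A₀ + (2 * (m + 24) + 1) ^ (d + 2) * s).choose s *
        ((2 * 13 + 1) ^ (d + 2)) ^ s * (2 * m + 1) ^ s * (∑ n ∈ Finset.range (2 * m + 1), count (d + 2) n) ^ s := by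
  classical
  have hM : ∀ ω ∈ T, ∃ M ⊆ S ω, ValidSet m 13 N ω M ∧ u ≤ M.card := by
    intro ω hω
    obtain ⟨hmem, -, hS, hu⟩ := hT ω hω
    obtain ⟨M, hMS, hv, hcard⟩ := exists_validSet 13 hmem (S ω) hS
    refine ⟨M, hMS, by exact_mod_cast hv, ?_⟩
    have : (4 * m + 1 + (4 * 13 + 1) ^ (d + 2) + 1) * u ≤ (4 * m + 1 + (4 * 13 + 1) ^ (d + 2) + 1) * M.card :=
      (by norm_num at hu ⊢; exact hu : _ ≤ (S ω).card).trans hcard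
    exact le_of_mul_le_mul_left this (by positivity)
  choose! M hMS hMv hMu using hM
  refine (card_mul_choose_le_sum T M u s hMu).trans ?_
  have := sum_choose_le_of_codes (fun w => vSites w.1 w.2) (cubeProvider d) N s (A₀ + (2 * (m + 24) + 1) ^ (d + 2) * s) T M
    (fun ω hω => hMv ω hω)
    (fun ω hω J hJ hs l hl => mem_vSites.2 (occV_mtimeOf ((hMv ω hω).subset hJ) hl))
    (fun ω hω J hJ hs => by
      rw [← hs]
      exact (vCount_PhiJ ((hMv ω hω).subset hJ)).trans (Nat.add_le_add_right (hT ω hω).2.1 _)) (by norm_num)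
  simpa using this

end Applications

end Literature.Probability.RandomPlanarGeometry.SAW.Zd
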